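import Literature.Analysis.FluidPDE.StationaryEulerLimit
import Literature.Analysis.FluidPDE.StationaryEulerHPrinciple
import Literature.Analysis.FunctionSpaces.TorusSobolevNormProofs
import HarnessLib

/-!
# Weak stationary Euler flows from a relaxed family (Choffrut–Székelyhidi 2014, §2)

Topic `Literature/Analysis/FluidPDE`. Support file of the proof of
`Literature.Analysis.FluidPDE.Torus.ChoffrutSzekelyhidi2014_thm1` (Choffrut–Székelyhidi, SIAM
J. Math. Anal. 46 (2014) = arXiv:1401.4301). **Proof of Theorem 1 assuming (P) and (*)**
(§2 of the paper), i.e. given a `RelaxedFamily`: the limit of the iteration started at the Euler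
state `w₀` of a smooth stationary flow is, by Lemma 2 of the paper, a bounded weak stationary
Euler flow `v` with `|v|² = e` a.e. and `‖v - v₀‖_{H⁻¹} < σ` (`exists_weakFlow`); and
"infinitely many": flows at strictly smaller `H⁻¹`-distances from `v₀` are pairwise not a.e.
equal (`exists_weakFlows`).

## References

* A. Choffrut, L. Székelyhidi Jr., SIAM J. Math. Anal. 46 (2014), §2 (proof of Thm. 1), Lemma 2.
-/

noncomputable section

open scoped InnerProductSpace ContDiff ENNReal Topology
open Set Function MeasureTheory Metric Filter UnitAddTorus
open Literature.Analysis.FunctionSpaces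

namespace Literature.Analysis.FluidPDE

namespace StationaryEuler

variable {d : Type*} [Fintype d] [DecidableEq d] [Nonempty d]

/-- The conclusion of Theorem 1 for a single flow `v`: bounded, weakly divergence free, weak
stationary Euler, `|v|² = e` a.e. [cite: ChoffrutSzekelyhidi2014, Thm. 1] -/
def IsWeakFlow (e : UnitAddTorus d → ℝ) (v : UnitAddTorus d → Ed d) : Prop :=
  MemLp v ∞ volume ∧ Torus.IsWeaklyDivFree v ∧
    (∀ w : UnitAddTorus d → Ed d, Torus.IsSmooth w → Torus.IsDivFree w → ∫ x, ⟪v x, Torus.convect v w x⟫_ℝ = 0) ∧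
    (∀ᵐ x ∂volume, ‖v x‖ ^ 2 = e x)

/-- The `H⁻¹` distance from `v₀`. [folklore] -/
def hDist (v₀ v : UnitAddTorus d → Ed d) : ℝ≥0∞ :=
  Torus.eSobolevNorm (-1) (EuclideanSpace.complexify ∘ fun x => v x - v₀ x)

/-- **One weak flow** (§2 of the paper: Steps 1–3 and Lemma 2, given the relaxed family): for a
smooth stationary Euler flow `(v₀, p₀)`, a continuous `e > |v₀|²` and `σ > 0` there is a weak flow
with `|v|² = e` a.e. and `‖v - v₀‖_{H⁻¹} < σ`. [cite: ChoffrutSzekelyhidi2014, Thm. 1, §2] -/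
theorem exists_weakFlow (𝓕 : RelaxedFamily d) {v₀ : UnitAddTorus d → Ed d} {p₀ : UnitAddTorus d → ℝ}
    {e : UnitAddTorus d → ℝ} (hv : Torus.IsSmooth v₀) (hp : Torus.IsSmooth p₀) (hdiv : Torus.IsDivFree v₀)
    (hE : ∀ x, Torus.convect v₀ v₀ x + Torus.gradient p₀ x = 0) (he : Continuous e) (hlt : ∀ x, ‖v₀ x‖ ^ 2 < e x)
    {σ : ℝ} (hσ : 0 < σ) :
    ∃ v : UnitAddTorus d → Ed d, IsWeakFlow e v ∧ hDist v₀ v < ENNReal.ofReal σ := by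
  set D : IterData d := ⟨𝓕, e, eulerState v₀, σ / 2, he, memX0_eulerState 𝓕 hv hp hdiv hE hlt, half_pos hσ⟩ with hD
  set v : UnitAddTorus d → Ed d := fun x => vel (D.wlim x) with hvdef
  have hvm : AEStronglyMeasurable v volume := continuous_vel.comp_aestronglyMeasurable D.aestronglyMeasurable_wlim
  have hvb : ∀ᵐ x, ‖v x‖ ≤ D.R := by
    filter_upwards [D.ae_norm_wlim_le] with x hx using (norm_vel_le _).trans hx
  refine ⟨v, ⟨memLp_top_of_bound hvm D.R hvb, fun θ hθ => ?_, fun Φ hΦ hΦdiv => ?_, ?_⟩, ?_⟩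
  · -- weakly divergence free
    have h1 : ∀ x, ⟪v x, Torus.gradient θ x⟫_ℝ = ∑ i, vel (D.wlim x) i * Torus.partialDeriv i θ x := fun x => by
      rw [real_inner_comm, Torus.inner_gradient_left, Torus.fderiv_apply_eq_sum_partialDeriv (hθ.isContDiff (by simp))]
      simp only [smul_eq_mul, hvdef]
    simp_rw [h1]
    exact D.wlim_weak_div hθ
  · -- weak Euler: `⟪v, DΦ[v]⟫ = Σᵢⱼ vᵢvⱼ∂ⱼΦᵢ = Σᵢⱼ uᵢⱼ∂ⱼΦᵢ + (e/d) div Φ` a.e.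
    have hpt : ∀ x, ⟪v x, Torus.convect v Φ x⟫_ℝ = ∑ i, ∑ j, v x i * v x j * Torus.partialDeriv j (fun y => Φ y i) x := by
      intro x
      rw [Torus.convect, PiLp.inner_apply]
      refine Finset.sum_congr rfl fun i _ => ?_
      simp only [RCLike.inner_apply, conj_trivial, fderiv_apply_apply hΦ, Finset.sum_mul]
      refine Finset.sum_congr rfl fun j _ => ?_
      ring
    have hae : (fun x => ⟪v x, Torus.convect v Φ x⟫_ℝ) =ᵐ[volume]
        fun x => ∑ i, ∑ j, str (D.wlim x) i j * Torus.partialDeriv j (fun y => Φ y i) x := by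
      filter_upwards [D.ae_wlim_mem_K] with x hx
      rw [hpt]
      have hstr : ∀ i j, str (D.wlim x) i j = v x i * v x j - if i = j then D.e x / Fintype.card d else 0 := by
        intro i j
        rw [hx.2, Matrix.sub_apply, Matrix.smul_apply, Matrix.one_apply]
        simp [tensorSelf, Matrix.vecMulVec_apply, hvdef]
      have hdivx : ∑ i, Torus.partialDeriv i (fun y => Φ y i) x = 0 := hΦdiv x
      simp_rw [hstr, sub_mul, Finset.sum_sub_distrib]
      have htr : ∑ i, ∑ j, (if i = j then D.e x / Fintype.card d else 0) * Torus.partialDeriv j (fun y => Φ y i) x = 0 := by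
        simp_rw [ite_mul, zero_mul, Finset.sum_ite_eq, Finset.mem_univ, if_true, ← Finset.mul_sum, hdivx, mul_zero]
      rw [htr, sub_zero]
    rw [integral_congr_ae hae]
    exact D.wlim_weak_str hΦ hΦdiv
  · -- `|v|² = e` a.e.
    filter_upwards [D.ae_norm_vel_wlim_sq] with x hx using hx
  · -- `‖v - v₀‖_{H⁻¹} ≤ σ/2 < σ`
    have h := D.eSobolevNorm_vel_wlim_sub_le
    have hθ : D.θ = σ / 2 := rfl
    have hw0 : ∀ x, vel (D.w₀ x) = v₀ x := fun x => vel_eulerState v₀ x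
    simp only [hw0, hθ] at h
    exact lt_of_le_of_lt h ((ENNReal.ofReal_lt_ofReal_iff hσ).2 (by linarith))

/-! ## Infinitely many flows -/

omit [DecidableEq d] [Nonempty d] in
/-- The `H⁻¹` distance depends only on the a.e. class. [folklore] -/
theorem hDist_congr_ae {v₀ v v' : UnitAddTorus d → Ed d} (h : v =ᵐ[volume] v') : hDist v₀ v = hDist v₀ v' := by
  have H : (EuclideanSpace.complexify ∘ fun x => v x - v₀ x) =ᵐ[volume] (EuclideanSpace.complexify ∘ fun x => v' x - v₀ x) :=
    h.mono fun x hx => by simp only [comp_apply, hx]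
  unfold hDist Torus.eSobolevNorm
  congr 1
  refine tsum_congr fun k => ?_
  rw [Torus.mFourierCoeff_congr_ae H]

omit [DecidableEq d] [Nonempty d] in
/-- **A flow different from `v₀` on a non-null set is at positive `H⁻¹` distance** (uniqueness of
Fourier coefficients in `L¹`). [folklore] -/
theorem hDist_pos {v₀ v : UnitAddTorus d → Ed d} (hint : Integrable (fun x => v x - v₀ x) volume)
    (h : ¬ (fun x => v x - v₀ x) =ᵐ[volume] 0) : 0 < hDist v₀ v := by
  set f : UnitAddTorus d → EuclideanSpace ℂ d := EuclideanSpace.complexify ∘ fun x => v x - v₀ x with hf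
  have hfi : Integrable f volume := Torus.integrable_complexify_comp hint
  -- some Fourier coefficient is non-zero
  have hk : ∃ k, mFourierCoeff f k ≠ 0 := by
    by_contra hall
    push Not at hall
    have hae : f =ᵐ[volume] 0 := Torus.ae_eq_of_forall_mFourierCoeff_eq hfi (integrable_zero _ _ _) fun k => by
      rw [hall k]; simp [mFourierCoeff]
    refine h (hae.mono fun x hx => ?_)
    have h1 : EuclideanSpace.complexify (v x - v₀ x) = 0 := hx
    have h2 : EuclideanSpace.complexify (v x - v₀ x) = EuclideanSpace.complexify 0 := by rw [h1, map_zero]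
    exact EuclideanSpace.complexify_injective h2
  obtain ⟨k, hk⟩ := hk
  unfold hDist Torus.eSobolevNorm
  have hterm : 0 < ENNReal.ofReal (Torus.sobolevWeight (-1) k ^ 2) * ‖mFourierCoeff f k‖ₑ ^ 2 :=
    ENNReal.mul_pos (ENNReal.ofReal_pos.2 (pow_pos (Torus.sobolevWeight_pos _ _) 2)).ne'
      (pow_ne_zero _ (enorm_ne_zero.2 hk))
  exact ENNReal.rpow_pos_of_nonneg (lt_of_lt_of_le hterm (ENNReal.le_tsum k)) (by norm_num)

omit [Nonempty d] in
/-- Weak flows with `|v|² = e > |v₀|²` a.e. differ from `v₀` on a non-null set. [folklore] -/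
theorem not_ae_eq_of_isWeakFlow {v₀ v : UnitAddTorus d → Ed d} {e : UnitAddTorus d → ℝ} (hlt : ∀ x, ‖v₀ x‖ ^ 2 < e x)
    (hv : IsWeakFlow e v) : ¬ (fun x => v x - v₀ x) =ᵐ[volume] 0 := by
  intro h
  have hfalse : ∀ᵐ x ∂(volume : Measure (UnitAddTorus d)), False := by
    filter_upwards [h, hv.2.2.2] with x hx he
    have hx' : v x = v₀ x := sub_eq_zero.1 (by simpa using hx)
    rw [hx'] at he
    linarith [hlt x]
  rw [eventually_false_iff_eq_bot, ae_eq_bot] at hfalse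
  exact (IsProbabilityMeasure.ne_zero (volume : Measure (UnitAddTorus d))) hfalse

omit [Nonempty d] in
/-- The difference of a weak flow and a smooth field is integrable. [folklore] -/
theorem integrable_sub_of_isWeakFlow {v₀ v : UnitAddTorus d → Ed d} {e : UnitAddTorus d → ℝ} (hv₀ : Continuous v₀)
    (hv : IsWeakFlow e v) : Integrable (fun x => v x - v₀ x) volume :=
  (hv.1.integrable le_top).sub hv₀.integrable_unitAddTorus

/-- **Infinitely many weak flows** (the "infinitely many" of Theorem 1, given the relaxed family):
for every `n` there are `n` pairwise not a.e. equal weak flows with `|v|² = e` a.e. and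
`‖v - v₀‖_{H⁻¹} < σ`, obtained at strictly decreasing `H⁻¹`-distances from `v₀` (each new radius is
the previous distance, which is positive since `|v|² = e > |v₀|²`). [cite: ChoffrutSzekelyhidi2014, Thm. 1] -/
theorem exists_weakFlows (𝓕 : RelaxedFamily d) {v₀ : UnitAddTorus d → Ed d} {p₀ : UnitAddTorus d → ℝ}
    {e : UnitAddTorus d → ℝ} (hv : Torus.IsSmooth v₀) (hp : Torus.IsSmooth p₀) (hdiv : Torus.IsDivFree v₀)
    (hE : ∀ x, Torus.convect v₀ v₀ x + Torus.gradient p₀ x = 0) (he : Continuous e) (hlt : ∀ x, ‖v₀ x‖ ^ 2 < e x)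
    {σ : ℝ} (hσ : 0 < σ) (n : ℕ) :
    ∃ v : Fin n → UnitAddTorus d → Ed d, (∀ i j, i ≠ j → ¬ (v i =ᵐ[volume] v j)) ∧
      ∀ i, IsWeakFlow e (v i) ∧ hDist v₀ (v i) < ENNReal.ofReal σ := by
  have key : ∀ σ', 0 < σ' → ∃ v : UnitAddTorus d → Ed d, IsWeakFlow e v ∧ hDist v₀ v < ENNReal.ofReal σ' := fun σ' h =>
    exists_weakFlow 𝓕 hv hp hdiv hE he hlt h
  -- positivity and finiteness of the distances of weak flows
  have hpos : ∀ v, IsWeakFlow e v → 0 < hDist v₀ v := fun v hvw =>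
    hDist_pos (integrable_sub_of_isWeakFlow hv.continuous hvw) (not_ae_eq_of_isWeakFlow hlt hvw)
  -- the recursion
  let next : (UnitAddTorus d → Ed d) → (UnitAddTorus d → Ed d) := fun u =>
    if h : 0 < (hDist v₀ u).toReal then Classical.choose (key _ h) else u
  let u : ℕ → UnitAddTorus d → Ed d := fun k => Nat.rec (Classical.choose (key σ hσ)) (fun _ w => next w) k
  have hstep : ∀ w, IsWeakFlow e w → hDist v₀ w < ENNReal.ofReal σ →
      IsWeakFlow e (next w) ∧ hDist v₀ (next w) < hDist v₀ w := by
    intro w hw hσw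
    have hfin : hDist v₀ w ≠ ⊤ := (lt_of_lt_of_le hσw le_top).ne
    have hr : 0 < (hDist v₀ w).toReal := ENNReal.toReal_pos (hpos _ hw).ne' hfin
    have h1 := Classical.choose_spec (key _ hr)
    have hn : next w = Classical.choose (key _ hr) := dif_pos hr
    rw [hn]
    exact ⟨h1.1, lt_of_lt_of_le h1.2 ENNReal.ofReal_toReal_le⟩
  have hgood : ∀ k, IsWeakFlow e (u k) ∧ hDist v₀ (u k) < ENNReal.ofReal σ := by
    intro k
    induction k with
    | zero => exact Classical.choose_spec (key σ hσ)
    | succ k ih =>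
      have h := hstep _ ih.1 ih.2
      exact ⟨h.1, h.2.trans ih.2⟩
  have hdec : ∀ k, hDist v₀ (u (k + 1)) < hDist v₀ (u k) := fun k => (hstep _ (hgood k).1 (hgood k).2).2
  have hanti : StrictAnti fun k => hDist v₀ (u k) := strictAnti_nat_of_succ_lt hdec
  refine ⟨fun i => u i, fun i j hij hae => ?_, fun i => ⟨(hgood i).1, (hgood i).2⟩⟩
  have hne : (i : ℕ) ≠ j := fun h => hij (Fin.ext h)
  exact hne (hanti.injective (hDist_congr_ae hae))

end StationaryEuler

end Literature.Analysis.FluidPDE
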